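import Literature.NumberTheory.ComplexMultiplication.EllipticUnits.ImaginaryQuadraticMainConjectureCarriers
import Literature.NumberTheory.EllipticCurves.KellerYin2024.CharacterModulePrufer
import HarnessLib

/-!
# The finite coefficients of the class-group row of Johnson-Leung–Kings 2011, Lemma 5.8:
# `(ℤ/p^k)(θ)`, its embedding in `(ℚ_p/ℤ_p)(θ) = (F/𝓞)(θ)`, and its PERFECT `Γ_K`-equivariant pairing
# with `μ_{p^k} ⊗ θ′` (`θ·θ′ = 1`) into `μ_{p^k}` — definitions with bodies and proved lemmas, no named fact

Topic `Literature/NumberTheory/ComplexMultiplication/EllipticUnits` (grouping sub-namespace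
`JohnsonLeungKings2011`). Companion of `ImaginaryQuadraticMainConjectureCarriers.lean` (seat `bsd-print-cf2-ty2`
g37: `charModPow`, `muTwist p θ k = μ_{p^k} ⊗ θ`) and of `KellerYin2024/CharacterModulePrufer.lean`
(`charModuleEquiv θ : charModule ∅ θ ≃+ ℚ_p/ℤ_p`, `unitChar θ`, `Γ_K`-equivariance). Cell `bsd-print-cf2`
(`run/shared/lean/pub/bsd-print-cf2/`), width seat `bsd-line-cf2c-w8` g8 (prover): plug (π2), part I, of the ROW 1
socket `ImaginaryQuadraticMainConjectureClassGroupRow.lean` (the class-group row `𝒜_∞^θ → H²(𝒪_K[1/p𝔣], Λ(θ′)(1))`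
of the (α3) kernel descent on `PrintCf2RubinValueTwo.MainConjClauseAtSplitTwoQuadDA`, stmt-BirchSwinnertonDyer-24721).

WHAT. Poitou–Tate duality at the layer `K̃_n` pairs `H²(G_S(K̃_n), μ_{p^k} ⊗ θ′)` with `H¹(G_S(K̃_n), M′)` for the
dual module `M′ = Hom(μ_{p^k} ⊗ θ′, μ_{p^k}) ≅ (ℤ/p^k)(θ)` when `θ·θ′ = 1` (Milne I §0, Cor. 2.3; [JLK] Def. 1.1:
"`M(η)_p` has Galois action through `η`"). The tree's layer pairing
(`PoitouTateShaRestrictedLayers.exists_shaRestricted_pairing_coind_of_natural_at`, cf2c-w8 g7) takes ANY equivariant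
bi-additive `B : M × M′ → μₙ` that is perfect on the right; this file supplies that datum for `M = μ_{p^k} ⊗ θ′`:

* §1 **`zmodTwist p θ k : DiscreteGaloisModule K (ZMod (p^k))`** — `(ℤ/p^k)(θ)`, `σ·a = (θσ mod p^k)·a`
  (`zmodTwist_apply`; trivial where `θ` is: `zmodTwist_apply_of_apply_eq_one`).
* §2 **`zmodToTorsion p k : ℤ/p^k →+ ℚ_p/ℤ_p`**, `a ↦ a·[p^{-k}]` (injective, `Γ_K`-compatible with the scalar
  action of `ℤ_p`: `zmodToTorsion_charModPow_mul`), and **`zmodToCharModule θ k : (ℤ/p^k)(unitChar θ) →+ (F/𝓞)(θ)`**,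
  `Γ_K`-EQUIVARIANT (`zmodToCharModule_galois`) and injective; the level inclusion `zmodIncl : ℤ/p^k → ℤ/p^{k+1}`,
  `a ↦ p·a`, compatible with both (`zmodToTorsion_zmodIncl`) and equivariant (`zmodTwist_zmodIncl`).
* §3 **`muZModPairing K p k : μ_{p^k} × ℤ/p^k → μ_{p^k}`**, `B(ζ, a) = ζ^a`; `Γ_K`-EQUIVARIANCE
  `B(σ·_{θ′}ζ, σ·_{θ}a) = σ·B(ζ, a)` when `θ′σ·θσ = 1` (`muZModPairing_equivariant`, the shape `hB` of the layer
  pairing); PERFECTNESS `a ↦ B(·, a)` bijective (`bijective_muZModPairing_flip`, the shape `hbij`); and the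
  reduction/inclusion adjointness `B_k(ζ^p, a) = B_{k+1}(ζ, p·a)` in `K̄ˣ` (`muZModPairing_muPowMap`, the shape of
  clause (N) for the level change).

HONEST FRAMING: coefficient bookkeeping; no duality theorem, no case of the main conjecture or of BSD is
proved here; no summit statement is proved by this seat. No named fact, no instance, no `sorry`.

## References
* [JohnsonLeungKings2011] J. Johnson-Leung, G. Kings, J. reine angew. Math. 653 (2011) = arXiv:0804.2828, §1.2
  Def. 1.1 (`𝒪_p(η)`, "Galois action through `η`", p0005:L1–30), §5.4 Lemma 5.8 (p0015:L150–165).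
* [MilneADT2006] J. S. Milne, *Arithmetic Duality Theorems*, 2nd ed., I §0 ("`M^D = Hom(M, μ)`"), I Cor. 2.3,
  I Thm. 4.10 (a) (p. 57).
* [NeukirchSchmidtWingberg2008] I §5 (1.5.3)(iv), VII §2 (`A′ = Hom(A, μ)`).
* [KellerYin2024] T. Keller, M. Yin, arXiv:2402.12781v2, §1.1 (`(F/𝓞)(θ)`).
-/

noncomputable section

open scoped NumberField
open Field IsDedekindDomain
open Literature.NumberTheory.GaloisRepresentations
open Literature.NumberTheory.GaloisRepresentations.DiscreteGaloisModule
open Literature.NumberTheory.EllipticCurves Literature.NumberTheory.EllipticCurves.KellerYin2024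
open Literature.NumberTheory.IwasawaTheory

namespace Literature.NumberTheory.ComplexMultiplication.EllipticUnits.JohnsonLeungKings2011

/-! ## §1 The twisted constant coefficients `(ℤ/p^k)(θ)` -/

section ZModTwist

variable {K : Type} [Field K] (p : ℕ) [Fact p.Prime] (θ : absoluteGaloisGroup K →ₜ* ℤ_[p]ˣ) (k : ℕ)

/-- The representation `σ ↦ (a ↦ (θσ mod p^k)·a)` of `Γ_K` on `ℤ/p^k` underlying `(ℤ/p^k)(θ)`.
[cite: JohnsonLeungKings2011, §1.2 Def. 1.1 (arXiv p0005:L1–30)] -/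
def zmodTwistRepresentation : Representation ℤ (absoluteGaloisGroup K) (ZMod (p ^ k)) :=
  (Algebra.lmul ℤ (ZMod (p ^ k))).toRingHom.toMonoidHom.comp (charModPow p θ k)

/-- Unfolding the twisted action. [cite: JohnsonLeungKings2011, §1.2 Def. 1.1 (arXiv p0005:L1–30)] -/
@[simp] theorem zmodTwistRepresentation_apply (σ : absoluteGaloisGroup K) (a : ZMod (p ^ k)) :
    zmodTwistRepresentation p θ k σ a = charModPow p θ k σ * a := rfl

/-- **`(ℤ/p^k)(θ)`**: the discrete `Γ_K`-module `ℤ/p^k` with `σ` acting by multiplication by `θ(σ) mod p^k`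
— the finite coefficients `𝒪_p(θ)/p^k` of [JLK] Def. 1.1 for `𝒪_p = ℤ_p` (no Tate twist). Continuity: the stabiliser
of every `a` contains the open kernel of `θ mod p^k`. [cite: JohnsonLeungKings2011, §1.2 Def. 1.1 (arXiv p0005:L1–30)] -/
def zmodTwist : DiscreteGaloisModule K (ZMod (p ^ k)) :=
  ContinuousRep.ofStabilizerMemNhdsOne (zmodTwistRepresentation p θ k) fun a => by
    have h1 : {σ : absoluteGaloisGroup K | charModPow p θ k σ = 1} ∈ nhds (1 : absoluteGaloisGroup K) :=
      ((isOpen_discrete ({1} : Set (ZMod (p ^ k)))).preimage (continuous_charModPow p θ k)).mem_nhds (by simp)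
    filter_upwards [h1] with σ hσ
    rw [zmodTwistRepresentation_apply, hσ, one_mul]

/-- Unfolding the action of `(ℤ/p^k)(θ)`. [cite: JohnsonLeungKings2011, §1.2 Def. 1.1 (arXiv p0005:L1–30)] -/
@[simp] theorem zmodTwist_apply (σ : absoluteGaloisGroup K) (a : ZMod (p ^ k)) :
    zmodTwist p θ k σ a = charModPow p θ k σ * a := rfl

/-- Where `θ` is trivial the action is trivial. [cite: JohnsonLeungKings2011, §4.2 ("unramified outside of `p𝔣_η`", arXiv p0012:L72–78)] -/
theorem zmodTwist_apply_of_apply_eq_one {σ : absoluteGaloisGroup K} (hσ : θ σ = 1) (a : ZMod (p ^ k)) :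
    zmodTwist p θ k σ a = a := by
  rw [zmodTwist_apply, charModPow_apply, hσ, Units.val_one, map_one, one_mul]

/-- The kernel of `θ` acts trivially on `(ℤ/p^k)(θ)`: `ker θ ≤ ker (ℤ/p^k)(θ)` (so `(ℤ/p^k)(θ)` is unramified
wherever `θ` is). [cite: JohnsonLeungKings2011, §4.2 (arXiv p0012:L72–78)] -/
theorem ker_le_ker_zmodTwist : (θ.toMonoidHom.ker : Subgroup (absoluteGaloisGroup K)) ≤ ContinuousRep.ker (zmodTwist p θ k) := by
  intro σ hσ
  rw [ContinuousRep.mem_ker]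
  refine LinearMap.ext fun a => ?_
  exact zmodTwist_apply_of_apply_eq_one p θ k (by simpa using hσ) a

omit [Fact p.Prime] in
/-- `(ℤ/p^k)(θ)` is killed by `p^k`. [cite: JohnsonLeungKings2011, §1.2 Def. 1.1 (arXiv p0005:L1–30)] -/
theorem zmodTwist_torsion (a : ZMod (p ^ k)) : p ^ k • a = 0 := by
  rw [nsmul_eq_mul, ZMod.natCast_self, zero_mul]

end ZModTwist

/-! ## §2 `(ℤ/p^k)(θ) ⊂ (ℚ_p/ℤ_p)(θ) = (F/𝓞)(θ)` -/

section Torsion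

variable (p : ℕ) [Fact p.Prime] (k : ℕ)

/-- `(p^k : ℤ) • t_k = 0` in `ℚ_p/ℤ_p`. [folklore] -/
private theorem natCast_pow_zsmul_tgen : ((p ^ k : ℕ) : ℤ) • QpModZp.tgen p k = 0 := by
  rw [natCast_zsmul, QpModZp.pow_nsmul_tgen]

/-- **`ℤ/p^k → ℚ_p/ℤ_p`, `a ↦ a·[p^{-k}]`** — the identification of `ℤ/p^k` with the `p^k`-torsion of the
Prüfer module (`ZMod.lift` of `m ↦ m·t_k`). [cite: MilneADT2006, I §0] -/
def zmodToTorsion : ZMod (p ^ k) →+ QpModZp p :=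
  ZMod.lift (p ^ k) ⟨zmultiplesHom (QpModZp p) (QpModZp.tgen p k), by
    rw [zmultiplesHom_apply]; exact natCast_pow_zsmul_tgen p k⟩

/-- `zmodToTorsion` on integers: `[m] ↦ m·t_k`. [cite: MilneADT2006, I §0] -/
@[simp] theorem zmodToTorsion_intCast (m : ℤ) : zmodToTorsion p k (m : ZMod (p ^ k)) = m • QpModZp.tgen p k := by
  rw [zmodToTorsion, ZMod.lift_coe, zmultiplesHom_apply]

/-- `zmodToTorsion` on naturals. [cite: MilneADT2006, I §0] -/
@[simp] theorem zmodToTorsion_natCast (m : ℕ) : zmodToTorsion p k (m : ZMod (p ^ k)) = m • QpModZp.tgen p k := by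
  rw [← Int.cast_natCast, zmodToTorsion_intCast, natCast_zsmul]

/-- `zmodToTorsion a = a.val · t_k`, with the scalar read in `ℤ_p`. [cite: MilneADT2006, I §0] -/
theorem zmodToTorsion_eq_val_smul (a : ZMod (p ^ k)) :
    zmodToTorsion p k a = (a.val : ℤ_[p]) • QpModZp.tgen p k := by
  conv_lhs => rw [← ZMod.natCast_zmod_val a]
  rw [zmodToTorsion_natCast, Nat.cast_smul_eq_nsmul]

/-- `c • t_k` only depends on `c` through a natural number `m ≡ c (mod p^k)`. [folklore] -/
private theorem smul_tgen_eq_natCast_smul_of_toZModPow_eq (c : ℤ_[p]) (m : ℕ) (h : PadicInt.toZModPow k c = m) :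
    c • QpModZp.tgen p k = (m : ℤ_[p]) • QpModZp.tgen p k := by
  apply QpModZp.smul_tgen_eq_of_sub_mem
  rw [← PadicInt.ker_toZModPow, RingHom.mem_ker, map_sub, h, map_natCast, sub_self]

/-- **`zmodToTorsion` is injective** (`c·t_k = 0 ↔ p^k ∣ c`). [cite: MilneADT2006, I §0] -/
theorem zmodToTorsion_injective : Function.Injective (zmodToTorsion p k) := by
  rw [injective_iff_map_eq_zero]
  intro a ha
  rw [zmodToTorsion_eq_val_smul, QpModZp.smul_tgen_eq_zero_iff, ← PadicInt.norm_le_pow_iff_mem_span_pow,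
    ← Int.cast_natCast, PadicInt.norm_int_le_pow_iff_dvd, ← Nat.cast_pow, Int.natCast_dvd_natCast] at ha
  obtain ⟨c, hc⟩ := ha
  rw [← ZMod.natCast_zmod_val a, hc, Nat.cast_mul, ZMod.natCast_self, zero_mul]

/-- **The image of `zmodToTorsion` is the `p^k`-torsion of `ℚ_p/ℤ_p`**: every `x` with `p^k x = 0` is `a·t_k`.
[cite: MilneADT2006, I §0] -/
theorem exists_zmodToTorsion_eq_of_nsmul_eq_zero {x : QpModZp p} (hx : p ^ k • x = 0) :
    ∃ a : ZMod (p ^ k), zmodToTorsion p k a = x := by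
  suffices h : ∃ u : ℤ_[p], x = u • QpModZp.tgen p k by
    obtain ⟨u, rfl⟩ := h
    exact ⟨(u.appr k : ℕ), by rw [zmodToTorsion_natCast, ← QpModZp.smul_tgen_eq_appr_smul]⟩
  obtain ⟨n, u, rfl⟩ := QpModZp.exists_eq_smul_tgen x
  rcases le_or_gt n k with hnk | hkn
  · obtain ⟨d, rfl⟩ := Nat.exists_eq_add_of_le hnk
    exact ⟨u * (p : ℤ_[p]) ^ d, by rw [mul_smul, QpModZp.pow_smul_tgen_add]⟩
  · obtain ⟨d, rfl⟩ := Nat.exists_eq_add_of_lt hkn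
    rw [← Nat.cast_smul_eq_nsmul ℤ_[p], Nat.cast_pow, smul_smul, QpModZp.smul_tgen_eq_zero_iff] at hx
    obtain ⟨e, he⟩ := Ideal.mem_span_singleton'.mp hx
    have hp0 : (p : ℤ_[p]) ^ k ≠ 0 := pow_ne_zero k (Nat.cast_ne_zero.mpr (Fact.out : p.Prime).ne_zero)
    have hu : u = e * (p : ℤ_[p]) ^ (d + 1) := mul_left_cancel₀ hp0 (by rw [← he]; ring)
    refine ⟨e, ?_⟩
    rw [hu, mul_smul]
    show e • (p : ℤ_[p]) ^ (d + 1) • QpModZp.tgen p (k + (d + 1)) = _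
    rw [QpModZp.pow_smul_tgen_add]

variable {K : Type} [Field K] (θ : absoluteGaloisGroup K →ₜ* ℤ_[p]ˣ)

/-- **Compatibility with the character**: `zmodToTorsion ((θσ mod p^k)·a) = θσ · zmodToTorsion a` — the embedding
`(ℤ/p^k)(θ) ⊂ (ℚ_p/ℤ_p)(θ)` is `Γ_K`-equivariant for the scalar action of `θ` on `ℚ_p/ℤ_p`.
[cite: JohnsonLeungKings2011, §1.2 Def. 1.1 (arXiv p0005:L1–30)] -/
theorem zmodToTorsion_charModPow_mul (σ : absoluteGaloisGroup K) (a : ZMod (p ^ k)) :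
    zmodToTorsion p k (charModPow p θ k σ * a) = ((θ σ : ℤ_[p]ˣ) : ℤ_[p]) • zmodToTorsion p k a := by
  rw [zmodToTorsion_eq_val_smul, zmodToTorsion_eq_val_smul, smul_smul,
    smul_tgen_eq_natCast_smul_of_toZModPow_eq p k (_ * _) ((charModPow p θ k σ * a).val) ?_]
  rw [map_mul, map_natCast, ZMod.natCast_zmod_val, ZMod.natCast_zmod_val, charModPow_apply]

end Torsion

section CharModule

variable {K : Type} [Field K] {p : ℕ} [Fact p.Prime]
  (θ : FramedGaloisRep K (padicCoeffIntegers (∅ : Set (PadicAlgCl p))) 1) (k : ℕ)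

/-- **`(ℤ/p^k)(unitChar θ) →+ (F/𝓞)(θ) = charModule ∅ θ`**: `zmodToTorsion` followed by `charModuleEquiv⁻¹`.
[cite: KellerYin2024, §1.1 (arXiv:2402.12781v2 TeX L441–449)] [cite: JohnsonLeungKings2011, §1.2 Def. 1.1 (arXiv p0005:L1–30)] -/
def zmodToCharModule : ZMod (p ^ k) →+ charModule (∅ : Set (PadicAlgCl p)) θ :=
  (charModuleEquiv θ).symm.toAddMonoidHom.comp (zmodToTorsion p k)

/-- Unfolding `zmodToCharModule` through `charModuleEquiv`. [cite: KellerYin2024, §1.1] -/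
theorem charModuleEquiv_zmodToCharModule (a : ZMod (p ^ k)) :
    charModuleEquiv θ (zmodToCharModule θ k a) = zmodToTorsion p k a :=
  (charModuleEquiv θ).apply_symm_apply _

/-- `zmodToCharModule` is injective. [cite: MilneADT2006, I §0] -/
theorem zmodToCharModule_injective : Function.Injective (zmodToCharModule θ k) :=
  (charModuleEquiv θ).symm.injective.comp (zmodToTorsion_injective p k)

/-- **`Γ_K`-EQUIVARIANCE of `(ℤ/p^k)(unitChar θ) ⊂ (F/𝓞)(θ)`**: `e((θσ mod p^k)·a) = σ • e(a)`.
[cite: KellerYin2024, §1.1 (arXiv:2402.12781v2 TeX L441–449)] [cite: JohnsonLeungKings2011, §1.2 Def. 1.1 (arXiv p0005:L1–30)] -/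
theorem zmodToCharModule_galois (σ : absoluteGaloisGroup K) (a : ZMod (p ^ k)) :
    zmodToCharModule θ k (charModPow p (unitChar θ) k σ * a) = σ • zmodToCharModule θ k a := by
  apply (charModuleEquiv θ).injective
  rw [charModuleEquiv_zmodToCharModule, charModuleEquiv_galois_smul, charModuleEquiv_zmodToCharModule,
    zmodToTorsion_charModPow_mul]

/-- `zmodToCharModule` lands in the `p^k`-torsion. [cite: MilneADT2006, I §0] -/
theorem pow_smul_zmodToCharModule (a : ZMod (p ^ k)) : p ^ k • zmodToCharModule θ k a = 0 := by
  rw [← map_nsmul, zmodTwist_torsion p k a, map_zero]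

end CharModule

/-! ### The level inclusion `ℤ/p^k → ℤ/p^{k+1}`, `a ↦ p·a` -/

section Incl

variable (p : ℕ) [Fact p.Prime] (k : ℕ)

/-- **The inclusion `ℤ/p^k → ℤ/p^{k+1}`, `a ↦ p·a`** (dual to the reduction `μ_{p^{k+1}} → μ_{p^k}`, `ζ ↦ ζ^p`).
[cite: Kato2004Asterisque, §8.2 (p. 180)] -/
def zmodIncl : ZMod (p ^ k) →+ ZMod (p ^ (k + 1)) :=
  ZMod.lift (p ^ k) ⟨(zmultiplesHom (ZMod (p ^ (k + 1))) (p : ZMod (p ^ (k + 1)))), by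
    rw [zmultiplesHom_apply, zsmul_eq_mul, Int.cast_natCast, Nat.cast_pow, ← pow_succ, ← Nat.cast_pow,
      ZMod.natCast_self]⟩

omit [Fact p.Prime] in
/-- `zmodIncl [m] = [p·m]`. [cite: Kato2004Asterisque, §8.2 (p. 180)] -/
@[simp] theorem zmodIncl_intCast (m : ℤ) : zmodIncl p k (m : ZMod (p ^ k)) = ((p * m : ℤ) : ZMod (p ^ (k + 1))) := by
  rw [zmodIncl, ZMod.lift_coe, zmultiplesHom_apply, zsmul_eq_mul, Int.cast_mul, Int.cast_natCast, mul_comm]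

/-- **Compatibility of the embeddings**: `zmodToTorsion_{k+1} (p·a) = zmodToTorsion_k a` (`p·t_{k+1} = t_k`).
[cite: MilneADT2006, I §0] -/
theorem zmodToTorsion_zmodIncl (a : ZMod (p ^ k)) :
    zmodToTorsion p (k + 1) (zmodIncl p k a) = zmodToTorsion p k a := by
  obtain ⟨m, rfl⟩ := ZMod.intCast_surjective a
  rw [zmodIncl_intCast, zmodToTorsion_intCast, zmodToTorsion_intCast, mul_comm, mul_zsmul, natCast_zsmul,
    ← Nat.cast_smul_eq_nsmul ℤ_[p], QpModZp.p_smul_tgen_succ]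

variable {K : Type} [Field K] (θ : absoluteGaloisGroup K →ₜ* ℤ_[p]ˣ)

/-- **`zmodIncl` is `Γ_K`-equivariant** `(ℤ/p^k)(θ) → (ℤ/p^{k+1})(θ)` (`θσ mod p^{k+1}` reduces to `θσ mod p^k`).
[cite: JohnsonLeungKings2011, §1.2 Def. 1.1 (arXiv p0005:L1–30)] -/
theorem zmodTwist_zmodIncl (σ : absoluteGaloisGroup K) (a : ZMod (p ^ k)) :
    zmodIncl p k (zmodTwist p θ k σ a) = zmodTwist p θ (k + 1) σ (zmodIncl p k a) := by
  obtain ⟨m, rfl⟩ := ZMod.intCast_surjective a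
  obtain ⟨t, ht⟩ := ZMod.intCast_surjective (PadicInt.toZModPow (k + 1) ((θ σ : ℤ_[p]ˣ) : ℤ_[p]))
  have hk : PadicInt.toZModPow k ((θ σ : ℤ_[p]ˣ) : ℤ_[p]) = (t : ZMod (p ^ k)) := by
    rw [← PadicInt.zmod_cast_comp_toZModPow k (k + 1) (Nat.le_succ k), RingHom.comp_apply, ← ht,
      ZMod.castHom_apply, ZMod.cast_intCast (pow_dvd_pow p (Nat.le_succ k))]
  rw [zmodTwist_apply, zmodTwist_apply, charModPow_apply, charModPow_apply, hk, ← ht, ← Int.cast_mul,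
    zmodIncl_intCast, zmodIncl_intCast, ← Int.cast_mul, mul_left_comm]

end Incl

/-! ## §3 The pairing `μ_{p^k} × ℤ/p^k → μ_{p^k}`, `(ζ, a) ↦ ζ^a` -/

section Pairing

variable (K : Type) [Field K] (p : ℕ) [Fact p.Prime] (k : ℕ)

omit [Fact p.Prime] in
/-- `(p^k : ℤ) • ζ = 0` for `ζ ∈ μ_{p^k}`. [folklore] -/
private theorem natCast_pow_zsmul_mu (ζ : MuCarrier K (p ^ k)) : ((p ^ k : ℕ) : ℤ) • ζ = 0 := by
  apply muVal_injective K (p ^ k)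
  rw [natCast_zsmul, muVal_nsmul, muVal_pow_eq_one, muVal_zero]

/-- **The pairing `B : μ_{p^k} × ℤ/p^k → μ_{p^k}`, `B(ζ, [m]) = m·ζ` (`= ζ^m` multiplicatively)** — the evaluation
pairing `Hom(M′, μ) × M′ → μ` read through `μ_{p^k} ⊗ θ′ ≅ Hom((ℤ/p^k)(θ), μ_{p^k})`. [cite: MilneADT2006, I §0 and I Cor. 2.3] [cite: NeukirchSchmidtWingberg2008, I §5 (1.5.3)(iv)] -/
def muZModPairing : MuCarrier K (p ^ k) →+ ZMod (p ^ k) →+ MuCarrier K (p ^ k) :=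
  AddMonoidHom.flip (ZMod.lift (p ^ k) ⟨(smulAddHom ℤ (MuCarrier K (p ^ k) →+ MuCarrier K (p ^ k))).flip
      (AddMonoidHom.id (MuCarrier K (p ^ k))), by
    ext ζ
    rw [AddMonoidHom.flip_apply, smulAddHom_apply, AddMonoidHom.zero_apply]
    exact natCast_pow_zsmul_mu K p k ζ⟩)

omit [Fact p.Prime] in
/-- `B(ζ, [m]) = m·ζ`. [cite: MilneADT2006, I §0] -/
@[simp] theorem muZModPairing_intCast (ζ : MuCarrier K (p ^ k)) (m : ℤ) :
    muZModPairing K p k ζ (m : ZMod (p ^ k)) = m • ζ := by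
  rw [muZModPairing, AddMonoidHom.flip_apply, ZMod.lift_coe, AddMonoidHom.flip_apply, smulAddHom_apply]
  rfl

/-- `B(ζ, a) = a.val·ζ`. [cite: MilneADT2006, I §0] -/
theorem muZModPairing_eq_val_nsmul (ζ : MuCarrier K (p ^ k)) (a : ZMod (p ^ k)) :
    muZModPairing K p k ζ a = a.val • ζ := by
  conv_lhs => rw [← ZMod.natCast_zmod_val a, ← Int.cast_natCast]
  rw [muZModPairing_intCast, natCast_zsmul]

/-- `B(ζ, a)` on underlying units: `muVal (B(ζ, a)) = (muVal ζ)^{a.val}`. [cite: MilneADT2006, I §0] -/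
theorem muVal_muZModPairing (ζ : MuCarrier K (p ^ k)) (a : ZMod (p ^ k)) :
    muVal K (p ^ k) (muZModPairing K p k ζ a) = muVal K (p ^ k) ζ ^ a.val := by
  rw [muZModPairing_eq_val_nsmul, muVal_nsmul]

variable {K p k}

omit [Fact p.Prime] in
/-- Powers of a `p^k`-th root of unity depend only on the exponent mod `p^k`. [folklore] -/
private theorem muVal_pow_mod (v : MuCarrier K (p ^ k)) (a : ℕ) :
    muVal K (p ^ k) v ^ (a % p ^ k) = muVal K (p ^ k) v ^ a := by
  conv_rhs => rw [← Nat.mod_add_div a (p ^ k), pow_add, pow_mul, muVal_pow_eq_one, one_pow, mul_one]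

variable (K p k)

/-- **`Γ_K`-EQUIVARIANCE of the pairing**: `B(σ ·_{θ′} ζ, σ ·_{θ} a) = σ · B(ζ, a)` whenever `θ′σ · θσ = 1`
(`μ_{p^k} ⊗ θ′` and `(ℤ/p^k)(θ)` are mutually dual into `μ_{p^k}`) — the hypothesis `hB` of the layer pairing.
[cite: MilneADT2006, I §0 and I Cor. 2.3] [cite: JohnsonLeungKings2011, §1.2 Def. 1.1 (arXiv p0005:L1–30)] -/
theorem muZModPairing_equivariant (θ θ' : absoluteGaloisGroup K →ₜ* ℤ_[p]ˣ)
    (hθ : ∀ σ : absoluteGaloisGroup K, ((θ' σ : ℤ_[p]ˣ) : ℤ_[p]) * ((θ σ : ℤ_[p]ˣ) : ℤ_[p]) = 1)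
    (σ : absoluteGaloisGroup K) (ζ : MuCarrier K (p ^ k)) (a : ZMod (p ^ k)) :
    muZModPairing K p k (muTwist p θ' k σ ζ) (zmodTwist p θ k σ a) = mu K (p ^ k) σ (muZModPairing K p k ζ a) := by
  have h1 : charModPow p θ' k σ * charModPow p θ k σ = 1 := by
    rw [charModPow_apply, charModPow_apply, ← map_mul, hθ, map_one]
  have hexp : ((charModPow p θ' k σ).val * (charModPow p θ k σ * a).val) % p ^ k = a.val := by
    rw [← ZMod.val_natCast, Nat.cast_mul, ZMod.natCast_zmod_val, ZMod.natCast_zmod_val, ← mul_assoc, h1, one_mul]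
  have e1 : muVal K (p ^ k) (muZModPairing K p k (muTwist p θ' k σ ζ) (zmodTwist p θ k σ a)) =
      muVal K (p ^ k) (mu K (p ^ k) σ ζ) ^ ((charModPow p θ' k σ).val * (charModPow p θ k σ * a).val) := by
    rw [muVal_muZModPairing, muVal_muTwist_apply, ← pow_mul, zmodTwist_apply]
  have e2 : muVal K (p ^ k) (mu K (p ^ k) σ (muZModPairing K p k ζ a)) = muVal K (p ^ k) (mu K (p ^ k) σ ζ) ^ a.val := by
    rw [muVal_apply, muVal_apply, muVal_muZModPairing, smul_pow']
  apply muVal_injective K (p ^ k)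
  rw [e1, e2, ← muVal_pow_mod (mu K (p ^ k) σ ζ) (_ * _), hexp]

/-- **Reduction is adjoint to inclusion**: `B_k(ζ^p, a) = B_{k+1}(ζ, p·a)` in `K̄ˣ` — the adjointness of the pair
(`μ_{p^{k+1}} → μ_{p^k}`, `ℤ/p^k → ℤ/p^{k+1}`) for the evaluation pairings, i.e. clause (N) of the layer Poitou–Tate
fact for the change of level `k`. [cite: MilneADT2006, §4 p. 65] [cite: Kato2004Asterisque, §8.2 (p. 180)] -/
theorem muZModPairing_muPowMap (ζ : MuCarrier K (p ^ (k + 1))) (a : ZMod (p ^ k)) :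
    muVal K (p ^ k) (muZModPairing K p k (muPowMap K (pow_dvd_pow p (Nat.le_succ k)) ζ) a) =
      muVal K (p ^ (k + 1)) (muZModPairing K p (k + 1) ζ (zmodIncl p k a)) := by
  have hdiv : p ^ (k + 1) / p ^ k = p := by
    rw [pow_succ, Nat.mul_div_cancel_left p (pow_pos (Fact.out : p.Prime).pos k)]
  have hval : (zmodIncl p k a).val = (p * a.val) % p ^ (k + 1) := by
    conv_lhs => rw [← ZMod.natCast_zmod_val a, ← Int.cast_natCast, zmodIncl_intCast, ← Nat.cast_mul, Int.cast_natCast,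
      ZMod.val_natCast]
  rw [muVal_muZModPairing, muVal_muPowMap, ← pow_mul, hdiv, muVal_muZModPairing, hval, muVal_pow_mod]

/-- **PERFECTNESS on the right**: `a ↦ B(·, a)` is a bijection `ℤ/p^k ≅ Hom(μ_{p^k}, μ_{p^k})` (`μ_{p^k}(K̄)` is cyclic
of order `p^k` in characteristic `0`) — the hypothesis `hbij` of the layer pairing. [cite: MilneADT2006, I §0 and I Cor. 2.3] -/
theorem bijective_muZModPairing_flip [CharZero K] :
    Function.Bijective fun a : ZMod (p ^ k) => (muZModPairing K p k).flip a := by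
  haveI : NeZero ((p ^ k : ℕ) : AlgebraicClosure K) := ⟨Nat.cast_ne_zero.2 (NeZero.ne (p ^ k))⟩
  haveI : IsAddCyclic (MuCarrier K (p ^ k)) :=
    inferInstanceAs (IsAddCyclic (Additive (rootsOfUnity (p ^ k) (AlgebraicClosure K))))
  have hcard : Nat.card (MuCarrier K (p ^ k)) = p ^ k :=
    HasEnoughRootsOfUnity.natCard_rootsOfUnity (AlgebraicClosure K) (p ^ k)
  obtain ⟨g, hg⟩ := IsAddCyclic.exists_generator (α := MuCarrier K (p ^ k))
  have hord : addOrderOf g = p ^ k := (addOrderOf_eq_card_of_forall_mem_zmultiples hg).trans hcard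
  constructor
  · intro a b hab
    have h : muZModPairing K p k g a = muZModPairing K p k g b := DFunLike.congr_fun hab g
    rw [muZModPairing_eq_val_nsmul, muZModPairing_eq_val_nsmul, nsmul_eq_nsmul_iff_modEq, hord] at h
    exact ZMod.val_injective _ (Nat.ModEq.eq_of_lt_of_lt h (ZMod.val_lt a) (ZMod.val_lt b))
  · intro f
    obtain ⟨m, hm⟩ := AddSubgroup.mem_zmultiples_iff.mp (hg (f g))
    refine ⟨(m : ZMod (p ^ k)), AddMonoidHom.ext fun ζ ↦ ?_⟩
    obtain ⟨j, rfl⟩ := AddSubgroup.mem_zmultiples_iff.mp (hg ζ)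
    rw [AddMonoidHom.flip_apply, muZModPairing_intCast, map_zsmul, ← hm, smul_comm]

end Pairing

end Literature.NumberTheory.ComplexMultiplication.EllipticUnits.JohnsonLeungKings2011

end
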